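import Literature.Barriers.CriticalPhenomena.GaussianDominationRouteProofs
import Mathlib.LinearAlgebra.Matrix.NonsingularInverse
import Mathlib.Analysis.Complex.Trigonometric
import HarnessLib

/-!
# The NoBLE equation: the `2d × 2d` matrix algebra of Fitzner–van der Hofstad (PROVED)

Sibling of `GaussianDominationRouteNoble.lean` / `GaussianDominationRouteNobleAnalysis.lean`
(barrier catalogue `Literature/Barriers/CriticalPhenomena/`), part (a) of the proof of the
percolation infrared bound in `d ≥ 11` at the level of linear algebra. The non-backtracking lace
expansion (NoBLE) produces two identities for the two-point function `τ̂(k)` and the `2d`-vector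
`τ⃗̂(k) = (τ̂^ι(k))_ι`, `ι ∈ {±1,…,±d}` (Fitzner–van der Hofstad 2017, Prop. 2.1, Fourier transformed in
§2.3; Fitzner–van der Hofstad [FitHof13b] §1.3):
`τ̂ = 1 + Ξ̂ + μ (1⃗ + Ψ⃗̂)ᵀ D[-k] τ⃗̂` and `τ̂ 1⃗ = τ⃗̂ + μ D[k] J τ⃗̂ + Π̂ D[-k] τ⃗̂ + Ξ⃗̂`, with the matrices
`(J)_{ι,κ} = δ_{ι,-κ}`, `(D[k])_{ι,κ} = δ_{ι,κ} e^{i k_ι}` (`k_{-ι} = -k_ι`). "The NoBLE equation … the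
workhorse behind our proof" (§2.3) is obtained by solving them:
`τ̂(k) = [1 + Ξ̂ - μ(1⃗+Ψ⃗̂)ᵀ (D[k] + μJ + Π̂)⁻¹ Ξ⃗̂] / [1 - μ(1⃗+Ψ⃗̂)ᵀ (D[k] + μJ + Π̂)⁻¹ 1⃗]`.
With all coefficients zero and `μ = z` this is the non-backtracking walk (NBW):
`B̂_z(k) = 1/(1 - z 1⃗ᵀ[D[k] + zJ]⁻¹ 1⃗) = (1 - z²)/(1 + (2d-1)z² - 2dz D̂(k))` (§2.1, "as derived in
detail in [FitHof13b]", using `[D[k] + zJ]⁻¹ = (D[-k] - zJ)/(1 - z²)`), whose value at the NBW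
critical point `z = 1/(2d-1)` is `((2d-2)/(2d-1)) / [1 - D̂(k)]` — the normalisation behind the
bootstrap function `f₂ = sup_k τ̂_p(k)/B̂_{1/(2d-1)}(k) = ((2d-1)/(2d-2)) sup_k [1 - D̂(k)] τ̂_p(k)`
(`nobleF2` of `GaussianDominationRouteNoble.lean`).

## What is formalised (namespace `Literature.Barriers.CriticalPhenomena`), all PROVED

* `kcomp k ι = k_ι`, the matrices `nobleJ d = J`, `nobleD d k = D[k]` over `ℂ`, indexed by
  `Fin d × Bool` (direction, sign; `srev` is `ι ↦ -ι`), and their algebra: `J² = 1`,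
  `D[k]D[-k] = 1`, `D[k]J = JD[-k]`, `(D[k] + μJ)(D[-k] - μJ) = (1 - μ²)·1`, hence
  `(D[k] + μJ)⁻¹ = (1-μ²)⁻¹ (D[-k] - μJ)` (`nobleDJ_inv`), `1⃗ᵀD[k]1⃗ = 2d D̂(k)`, `1⃗ᵀJ1⃗ = 2d`;
* `noble_vector_solve` (`τ⃗̂ = D[k](D[k]+μJ+Π̂)⁻¹(τ̂1⃗ - Ξ⃗̂)`) and **the NoBLE equation**
  `noble_equation`, for ANY complex data satisfying the two identities with `D[k]+μJ+Π̂` invertible;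
* **the NBW two-point function** `nbw_equation` (`B̂(1 + (2d-1)z² - 2dzD̂(k)) = 1 - z²` for any
  solution of the NBW scheme, `z² ≠ 1`) and the critical link `nbw_critical_link`
  (`(1-z²)/(1+(2d-1)z²-2dzD̂) = ((2d-2)/(2d-1))/(1-D̂)` at `z = 1/(2d-1)`, `D̂ ≠ 1`).

Not here: the NoBLE coefficients themselves (FvdH 2017 §3) and the combinatorial NBW recursion in
`x`-space (the tree counts NBWs in `Literature.Probability.Percolation.nbwWordsTo`); the statements
below are about arbitrary solutions of the `k`-space identities.

## References

* R. Fitzner, R. van der Hofstad, Electron. J. Probab. 22 (2017) no. 43 (arXiv:1506.07977): §2.1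
  (matrices `J`, `D[k]`, the NBW scheme and its solution, the link `B̂_{1/(2d-1)} = ((2d-2)/(2d-1)) Ĉ_{1/2d}`),
  Prop. 2.1, §2.3 ("The NoBLE-equation").
* R. Fitzner, R. van der Hofstad, Probab. Theory Relat. Fields 169 (2017) (arXiv:1506.07969,
  [FitHof13b]): §1.2.2 (NBW), §1.3 (general NoBLE form), §4.1.2 ("`(D[k] + μJ)⁻¹ = (D[-k] - μJ)/(1-μ²)`").
* M. Heydenreich, R. van der Hofstad, *Progress in High-Dimensional Percolation and Random Graphs*
  (Springer 2017), §10.2–§10.3: (10.2.11) (`J`, `D̂(k)`), (10.2.13) with Exercise 10.1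
  (`D̂(k)J = JD̂(-k)`, `D̂(k)⁻¹ = D̂(-k)`, `JJ = I`), (10.2.14)–(10.2.17) (NBW scheme in matrix form and
  `B̂_z(k) = 1/(1 - z1⃗ᵀ[D̂(k)+zJ]⁻¹1⃗)`), (10.2.18) (the inverse), (10.2.19) and Lemma 10.3 with
  (10.2.8)–(10.2.9); (10.3.12)–(10.3.13) (the Fourier identities), (10.3.17)–(10.3.18) (vector form
  and its solution), (10.3.21) with Exercise 10.4 (the NoBLE equation).
-/

noncomputable section

namespace Literature.Barriers.CriticalPhenomena

open Matrix Literature.Probability.Percolation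
open scoped BigOperators

variable {d : ℕ}

/-! ### Directions `ι ∈ {±1,…,±d}`, `k_ι`, and the matrices `J`, `D[k]` -/

/-- `k_ι` for a direction `ι = (j, ±) ∈ {±1,…,±d}`: `k_{+j} = k_j`, `k_{-j} = -k_j` ("for negative index
`ι` we write `k_ι = -k_{|ι|}`"). [cite: FitznerVanDerHofstad2017, §2.1 (k_ι = -k_{|ι|} for negative ι)]
[cite: HeydenreichVanDerHofstad2017, §10.2 (line before Lemma 10.3)] -/
def kcomp (k : Fin d → ℝ) (ι : Fin d × Bool) : ℝ := if ι.2 then k ι.1 else -k ι.1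

/-- `k_{-ι} = -k_ι`. [cite: FitznerVanDerHofstad2017, §2.1] -/
@[simp] theorem kcomp_srev (k : Fin d → ℝ) (ι : Fin d × Bool) : kcomp k (srev ι) = -kcomp k ι := by
  obtain ⟨j, b⟩ := ι; cases b <;> simp [kcomp, srev]

/-- `(-k)_ι = -k_ι`. [folklore] -/
@[simp] theorem kcomp_neg (k : Fin d → ℝ) (ι : Fin d × Bool) : kcomp (-k) ι = -kcomp k ι := by
  obtain ⟨j, b⟩ := ι; cases b <;> simp [kcomp]

/-- The matrix `J ∈ ℂ^{2d×2d}`, `(J)_{ι,κ} = δ_{ι,-κ}`. [cite: FitznerVanDerHofstad2017, §2.1 (definition of J)]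
[cite: HeydenreichVanDerHofstad2017, (10.2.11)] -/
def nobleJ (d : ℕ) : Matrix (Fin d × Bool) (Fin d × Bool) ℂ :=
  Matrix.of fun ι κ => if κ = srev ι then 1 else 0

/-- The diagonal matrix `D[k] ∈ ℂ^{2d×2d}`, `(D[k])_{ι,κ} = δ_{ι,κ} e^{i k_ι}`.
[cite: FitznerVanDerHofstad2017, §2.1 (definition of D[k])] [cite: HeydenreichVanDerHofstad2017, (10.2.11)] -/
def nobleD (d : ℕ) (k : Fin d → ℝ) : Matrix (Fin d × Bool) (Fin d × Bool) ℂ :=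
  Matrix.diagonal fun ι => Complex.exp ((kcomp k ι : ℂ) * Complex.I)

/-- `(J A)_{ι,κ} = A_{-ι,κ}`. [folklore] -/
theorem nobleJ_mul_apply (A : Matrix (Fin d × Bool) (Fin d × Bool) ℂ) (ι κ : Fin d × Bool) :
    (nobleJ d * A) ι κ = A (srev ι) κ := by
  simp [nobleJ, Matrix.mul_apply]

/-- `(A J)_{ι,κ} = A_{ι,-κ}`. [folklore] -/
theorem mul_nobleJ_apply (A : Matrix (Fin d × Bool) (Fin d × Bool) ℂ) (ι κ : Fin d × Bool) :
    (A * nobleJ d) ι κ = A ι (srev κ) := by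
  rw [Matrix.mul_apply, Fintype.sum_eq_single (srev κ)]
  · simp [nobleJ]
  · intro m hm
    have hne : ¬ κ = srev m := fun h => hm (by rw [h, srev_srev])
    simp [nobleJ, hne]

/-- `(J v)_ι = v_{-ι}`. [folklore] -/
theorem nobleJ_mulVec (v : Fin d × Bool → ℂ) : nobleJ d *ᵥ v = fun ι => v (srev ι) := by
  ext ι
  simp [nobleJ, Matrix.mulVec, dotProduct]

/-- `J² = 1`. [cite: HeydenreichVanDerHofstad2017, (10.2.13) and Exercise 10.1 ("JJ = I")] -/
theorem nobleJ_mul_nobleJ : nobleJ d * nobleJ d = 1 := by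
  ext ι κ
  rw [nobleJ_mul_apply, nobleJ, Matrix.of_apply, Matrix.one_apply]
  by_cases h : ι = κ
  · subst h; simp
  · rw [if_neg, if_neg h]
    intro hκ
    exact h (by rw [hκ, srev_srev])

/-- `D[k] D[-k] = 1`. [cite: HeydenreichVanDerHofstad2017, (10.2.13) and Exercise 10.1 ("D̂(k)⁻¹ = D̂(-k)")] -/
theorem nobleD_mul_nobleD_neg (k : Fin d → ℝ) : nobleD d k * nobleD d (-k) = 1 := by
  rw [nobleD, nobleD, Matrix.diagonal_mul_diagonal, ← Matrix.diagonal_one]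
  congr 1
  funext ι
  rw [← Complex.exp_add, kcomp_neg]
  simp

/-- `D[-k] D[k] = 1`. [cite: HeydenreichVanDerHofstad2017, (10.2.13) and Exercise 10.1 ("D̂(k)⁻¹ = D̂(-k)")] -/
theorem nobleD_neg_mul_nobleD (k : Fin d → ℝ) : nobleD d (-k) * nobleD d k = 1 := by
  simpa using nobleD_mul_nobleD_neg (d := d) (-k)

/-- `D[k] J = J D[-k]` (as `k_{-ι} = -k_ι`). [cite: FitznerVanDerHofstad2017, §2.3 ("by D[k]J = JD[-k]")]
[cite: HeydenreichVanDerHofstad2017, (10.2.13) and Exercise 10.1] -/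
theorem nobleD_mul_nobleJ (k : Fin d → ℝ) : nobleD d k * nobleJ d = nobleJ d * nobleD d (-k) := by
  ext ι κ
  rw [mul_nobleJ_apply, nobleJ_mul_apply, nobleD, nobleD, Matrix.diagonal_apply, Matrix.diagonal_apply]
  by_cases h : ι = srev κ
  · subst h
    simp
  · have h' : ¬ srev ι = κ := fun h2 => h (by rw [← h2, srev_srev])
    rw [if_neg h, if_neg h']

/-- `J D[k] = D[-k] J`. [cite: HeydenreichVanDerHofstad2017, (10.2.13) and Exercise 10.1] -/
theorem nobleJ_mul_nobleD (k : Fin d → ℝ) : nobleJ d * nobleD d k = nobleD d (-k) * nobleJ d := by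
  simpa using (nobleD_mul_nobleJ (d := d) (-k)).symm

/-- `(D[k] + μJ)(D[-k] - μJ) = (1 - μ²) 1`. [cite: FitznerVanDerHofstad2016NoBLE, §4.1.2 ("(D[k]+μJ)⁻¹ = (D[-k]-μJ)/(1-μ²)")]
[cite: FitznerVanDerHofstad2017, §2.1 ("[D[k]+zJ]⁻¹ = (1/(1-z²))(D[-k] - zJ)")] [cite: HeydenreichVanDerHofstad2017, (10.2.18)] -/
theorem nobleDJ_mul (k : Fin d → ℝ) (μ : ℂ) :
    (nobleD d k + μ • nobleJ d) * (nobleD d (-k) - μ • nobleJ d) = (1 - μ ^ 2) • (1 : Matrix _ _ ℂ) := by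
  rw [add_mul, mul_sub, mul_sub, nobleD_mul_nobleD_neg, Matrix.mul_smul, nobleD_mul_nobleJ,
    Matrix.smul_mul, Matrix.smul_mul, Matrix.mul_smul, nobleJ_mul_nobleJ, smul_smul, sub_smul, one_smul,
    pow_two]
  abel

/-- **`[D[k] + μJ]⁻¹ = (1 - μ²)⁻¹ (D[-k] - μJ)`** for `μ² ≠ 1`.
[cite: HeydenreichVanDerHofstad2017, (10.2.18)] [cite: FitznerVanDerHofstad2016NoBLE, §4.1.2] [cite: FitznerVanDerHofstad2017, §2.1] -/
theorem nobleDJ_inv (k : Fin d → ℝ) {μ : ℂ} (hμ : μ ^ 2 ≠ 1) :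
    (nobleD d k + μ • nobleJ d)⁻¹ = (1 - μ ^ 2)⁻¹ • (nobleD d (-k) - μ • nobleJ d) := by
  refine Matrix.inv_eq_right_inv ?_
  rw [Matrix.mul_smul, nobleDJ_mul, smul_smul, inv_mul_cancel₀ (sub_ne_zero.2 (Ne.symm hμ)), one_smul]

/-- `[D[k] + μJ]` is invertible for `μ² ≠ 1`. [cite: HeydenreichVanDerHofstad2017, (10.2.18)] -/
theorem isUnit_det_nobleDJ (k : Fin d → ℝ) {μ : ℂ} (hμ : μ ^ 2 ≠ 1) :
    IsUnit (nobleD d k + μ • nobleJ d).det := by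
  refine Matrix.isUnit_det_of_right_inverse (B := (1 - μ ^ 2)⁻¹ • (nobleD d (-k) - μ • nobleJ d)) ?_
  rw [Matrix.mul_smul, nobleDJ_mul, smul_smul, inv_mul_cancel₀ (sub_ne_zero.2 (Ne.symm hμ)), one_smul]

/-- `1⃗ᵀ D[k] 1⃗ = Σ_ι e^{i k_ι} = Σ_j 2cos(k_j) = 2d D̂(k)`. [cite: HeydenreichVanDerHofstad2017, (10.2.19) ("using 1⃗ᵀD̂(-k)1⃗ = 2dD̂(k)")]
[cite: FitznerVanDerHofstad2017, §2.1 (passage from B̂_z = 1/(1 - z1⃗ᵀ[D[k]+zJ]⁻¹1⃗) to its closed form)] -/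
theorem one_dotProduct_nobleD_mulVec_one (k : Fin d → ℝ) :
    (1 : Fin d × Bool → ℂ) ⬝ᵥ (nobleD d k *ᵥ 1) = 2 * d * (Dhat d k : ℂ) := by
  rw [nobleD, one_dotProduct]
  simp only [Matrix.mulVec_diagonal, Pi.one_apply, mul_one]
  rw [Fintype.sum_prod_type]
  have h : ∀ j : Fin d, ∑ b : Bool, Complex.exp ((kcomp k (j, b) : ℂ) * Complex.I) =
      2 * (Real.cos (k j) : ℂ) := fun j => by
    rw [Fintype.sum_bool]
    simp only [kcomp, Bool.false_eq_true, if_false, if_true, Complex.ofReal_neg, neg_mul]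
    rw [Complex.ofReal_cos, Complex.two_cos, neg_mul]
  rw [Finset.sum_congr rfl fun j _ => h j, ← Finset.mul_sum]
  rcases Nat.eq_zero_or_pos d with hd | hd
  · subst hd; simp
  · have hd' : (d : ℂ) ≠ 0 := by exact_mod_cast hd.ne'
    rw [Dhat_def, Complex.ofReal_div, Complex.ofReal_sum, Complex.ofReal_natCast]
    field_simp

/-- `1⃗ᵀ J 1⃗ = 2d`. [folklore] -/
theorem one_dotProduct_nobleJ_mulVec_one :
    (1 : Fin d × Bool → ℂ) ⬝ᵥ (nobleJ d *ᵥ 1) = 2 * d := by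
  rw [nobleJ_mulVec, one_dotProduct]
  simp [Fintype.card_prod, mul_comm]

/-! ### The NoBLE equation -/

/-- **Solving the vector identity** (FvdH 2017 §2.3, the display before the NoBLE equation;
[FitHof13b] §1.3): if `τ̂ 1⃗ = τ⃗̂ + μ D[k] J τ⃗̂ + Π̂ D[-k] τ⃗̂ + Ξ⃗̂` and `M = D[k] + μJ + Π̂` is invertible,
then `D[-k] τ⃗̂ = M⁻¹(τ̂ 1⃗ - Ξ⃗̂)`, i.e. `τ⃗̂ = D[k] M⁻¹ (τ̂ 1⃗ - Ξ⃗̂)` (using `τ⃗̂ = D[k]D[-k]τ⃗̂` and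
`D[k]J = JD[-k]`). [cite: HeydenreichVanDerHofstad2017, (10.3.17)–(10.3.18)]
[cite: FitznerVanDerHofstad2017, §2.3 (solution for the vector τ⃗̂(k))]
[cite: FitznerVanDerHofstad2016NoBLE, §1.3 (solution for G⃗̂_z(k))] -/
theorem noble_vector_solve (k : Fin d → ℝ) {τh μ : ℂ} {τv Ξv : Fin d × Bool → ℂ}
    {Pm : Matrix (Fin d × Bool) (Fin d × Bool) ℂ}
    (h2 : τh • (1 : Fin d × Bool → ℂ) =
      τv + μ • (nobleD d k *ᵥ (nobleJ d *ᵥ τv)) + Pm *ᵥ (nobleD d (-k) *ᵥ τv) + Ξv)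
    (hM : IsUnit (nobleD d k + μ • nobleJ d + Pm).det) :
    nobleD d (-k) *ᵥ τv = (nobleD d k + μ • nobleJ d + Pm)⁻¹ *ᵥ (τh • 1 - Ξv) ∧
      τv = nobleD d k *ᵥ ((nobleD d k + μ • nobleJ d + Pm)⁻¹ *ᵥ (τh • 1 - Ξv)) := by
  set M := nobleD d k + μ • nobleJ d + Pm with hMdef
  -- `M (D[-k] τ⃗̂) = τ̂ 1⃗ - Ξ⃗̂`
  have key : M *ᵥ (nobleD d (-k) *ᵥ τv) = τh • 1 - Ξv := by
    have e1 : nobleD d k *ᵥ (nobleD d (-k) *ᵥ τv) = τv := by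
      rw [Matrix.mulVec_mulVec, nobleD_mul_nobleD_neg, Matrix.one_mulVec]
    have e2 : nobleJ d *ᵥ (nobleD d (-k) *ᵥ τv) = nobleD d k *ᵥ (nobleJ d *ᵥ τv) := by
      rw [Matrix.mulVec_mulVec, Matrix.mulVec_mulVec, nobleD_mul_nobleJ]
    rw [hMdef, Matrix.add_mulVec, Matrix.add_mulVec, Matrix.smul_mulVec, e1, e2, h2]
    abel
  have hsol : nobleD d (-k) *ᵥ τv = M⁻¹ *ᵥ (τh • 1 - Ξv) := by
    rw [← key, Matrix.mulVec_mulVec, Matrix.nonsing_inv_mul _ hM, Matrix.one_mulVec]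
  refine ⟨hsol, ?_⟩
  rw [← hsol, Matrix.mulVec_mulVec, nobleD_mul_nobleD_neg, Matrix.one_mulVec]

/-- **The NoBLE equation** (Fitzner–van der Hofstad 2017, §2.3: "Thus, we can solve the above
equation as `τ̂(k) = [1 + Ξ̂_M(k) - μ(1⃗+Ψ⃗̂_M)ᵀ(D[k]+μJ+Π̂_M)⁻¹Ξ⃗̂_M] / [1 - μ(1⃗+Ψ⃗̂_M)ᵀ(D[k]+μJ+Π̂_M)⁻¹1⃗]`
… the NoBLE equation, and is the workhorse behind our proof"; [FitHof13b] §1.3,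
`Ĝ_z(k) = Φ̂_z(k)/(1 - F̂_z(k))`), in multiplied-out form, for ANY complex data satisfying the two
Fourier-space expansion identities with `D[k]+μJ+Π̂` invertible:
`τ̂ [1 - μ(1⃗+Ψ⃗̂)ᵀM⁻¹1⃗] = 1 + Ξ̂ - μ(1⃗+Ψ⃗̂)ᵀM⁻¹Ξ⃗̂` (the hypotheses are HvdH (10.3.12) and the
vector form (10.3.17) of (10.3.13); the conclusion is (10.3.21), Exercise 10.4, in FvdH's signs).
[cite: FitznerVanDerHofstad2017, §2.3 (the NoBLE equation)] [cite: HeydenreichVanDerHofstad2017, (10.3.12)–(10.3.13), (10.3.17), (10.3.21) and Exercise 10.4]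
[cite: FitznerVanDerHofstad2016NoBLE, §1.3 (Ĝ_z = Φ̂_z/(1-F̂_z))] -/
theorem noble_equation (k : Fin d → ℝ) {τh Ξh μ : ℂ} {τv Ξv Ψv : Fin d × Bool → ℂ}
    {Pm : Matrix (Fin d × Bool) (Fin d × Bool) ℂ}
    (h1 : τh = 1 + Ξh + μ * ((1 + Ψv) ⬝ᵥ (nobleD d (-k) *ᵥ τv)))
    (h2 : τh • (1 : Fin d × Bool → ℂ) =
      τv + μ • (nobleD d k *ᵥ (nobleJ d *ᵥ τv)) + Pm *ᵥ (nobleD d (-k) *ᵥ τv) + Ξv)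
    (hM : IsUnit (nobleD d k + μ • nobleJ d + Pm).det) :
    τh * (1 - μ * ((1 + Ψv) ⬝ᵥ ((nobleD d k + μ • nobleJ d + Pm)⁻¹ *ᵥ 1))) =
      1 + Ξh - μ * ((1 + Ψv) ⬝ᵥ ((nobleD d k + μ • nobleJ d + Pm)⁻¹ *ᵥ Ξv)) := by
  obtain ⟨hsol, -⟩ := noble_vector_solve k h2 hM
  rw [hsol, Matrix.mulVec_sub, Matrix.mulVec_smul, dotProduct_sub, dotProduct_smul, smul_eq_mul] at h1
  linear_combination h1

/-! ### The non-backtracking walk -/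

/-- **The NBW two-point function in `k`-space** (Fitzner–van der Hofstad 2017, §2.1: from the NBW
scheme `B̂_z(k) = 1 + z1⃗ᵀD[-k]B⃗̂_z(k)`, `B̂_z(k)1⃗ = B⃗̂_z(k) + zD[k]JB⃗̂_z(k)` one gets
`B̂_z(k) = 1/(1 - z1⃗ᵀ[D[k]+zJ]⁻¹1⃗) = (1-z²)/(1+(2d-1)z²-2dzD̂(k))`, "using that
`[D[k]+zJ]⁻¹ = (1/(1-z²))(D[-k]-zJ)`"; HvdH Lemma 10.3), in multiplied-out form, for any complex
solution of the scheme with `z² ≠ 1`: `B̂ (1 + (2d-1)z² - 2dz D̂(k)) = 1 - z²` (HvdH (10.2.14) writes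
the second identity as `B̂1⃗ = JB⃗ + zD̂(-k)B⃗`, the same equation read at `-ι`; (10.2.17), (10.2.19)).
[cite: HeydenreichVanDerHofstad2017, Lemma 10.3 (10.2.8) with (10.2.14), (10.2.17), (10.2.19)]
[cite: FitznerVanDerHofstad2017, §2.1 (NBW scheme and its solution)] [cite: FitznerVanDerHofstad2016NoBLE, §1.2.2] -/
theorem nbw_equation (k : Fin d → ℝ) {Bh z : ℂ} {Bv : Fin d × Bool → ℂ} (hz : z ^ 2 ≠ 1)
    (h1 : Bh = 1 + z * ((1 : Fin d × Bool → ℂ) ⬝ᵥ (nobleD d (-k) *ᵥ Bv)))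
    (h2 : Bh • (1 : Fin d × Bool → ℂ) = Bv + z • (nobleD d k *ᵥ (nobleJ d *ᵥ Bv))) :
    Bh * (1 + (2 * d - 1) * z ^ 2 - 2 * d * z * Dhat d k) = 1 - z ^ 2 := by
  have h1' : Bh = 1 + 0 + z * ((1 + 0) ⬝ᵥ (nobleD d (-k) *ᵥ Bv)) := by simpa using h1
  have h2' : Bh • (1 : Fin d × Bool → ℂ) = Bv + z • (nobleD d k *ᵥ (nobleJ d *ᵥ Bv)) +
      (0 : Matrix (Fin d × Bool) (Fin d × Bool) ℂ) *ᵥ (nobleD d (-k) *ᵥ Bv) + 0 := by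
    simpa using h2
  have hM : IsUnit (nobleD d k + z • nobleJ d + 0).det := by
    rw [add_zero]; exact isUnit_det_nobleDJ k hz
  have heq := noble_equation k h1' h2' hM
  simp only [add_zero, Matrix.mulVec_zero, dotProduct_zero, mul_zero, sub_zero] at heq
  rw [nobleDJ_inv k hz, Matrix.smul_mulVec, Matrix.sub_mulVec, Matrix.smul_mulVec,
    dotProduct_smul, dotProduct_sub, dotProduct_smul, one_dotProduct_nobleD_mulVec_one,
    one_dotProduct_nobleJ_mulVec_one, Dhat_neg, smul_eq_mul, smul_eq_mul] at heq
  have h1z : (1 : ℂ) - z ^ 2 ≠ 0 := sub_ne_zero.2 (Ne.symm hz)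
  -- `heq : Bh * (1 - z * ((1 - z²)⁻¹ * (2dD̂ - z·2d))) = 1`; clear the denominator
  field_simp at heq
  linear_combination heq

/-- **The NBW and SRW critical two-point functions are related by
`B̂_{1/(2d-1)}(k) = ((2d-2)/(2d-1)) Ĉ_{1/2d}(k) = ((2d-2)/(2d-1)) / [1 - D̂(k)]`**: at `z = 1/(2d-1)`,
`(1 - z²)/(1 + (2d-1)z² - 2dz D̂) = ((2d-2)/(2d-1)) / (1 - D̂)` (`d ≥ 1`, `D̂ ≠ 1`).
[cite: HeydenreichVanDerHofstad2017, Lemma 10.3 (10.2.9)]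
[cite: FitznerVanDerHofstad2017, §2.1 (link between the NBW and SRW critical two-point functions)]
[cite: FitznerVanDerHofstad2016NoBLE, Assumption 2.2 (B_{1/(2d-1)} = ((2d-2)/(2d-1)) C_{1/2d})] -/
theorem nbw_critical_link (hd : 1 ≤ d) {D : ℝ} (hD : D ≠ 1) :
    (1 - (1 / (2 * d - 1)) ^ 2) / (1 + (2 * d - 1) * (1 / (2 * d - 1)) ^ 2 - 2 * d * (1 / (2 * d - 1)) * D) =
      (2 * d - 2) / (2 * d - 1) * (1 / (1 - D)) := by
  have hd' : (1 : ℝ) ≤ d := by exact_mod_cast hd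
  have hd0 : (d : ℝ) ≠ 0 := by
    have : (0 : ℝ) < d := by linarith
    exact this.ne'
  have h1 : (2 * d - 1 : ℝ) ≠ 0 := by
    have : (0 : ℝ) < 2 * d - 1 := by linarith
    exact this.ne'
  have h2 : (1 - D : ℝ) ≠ 0 := sub_ne_zero.2 (Ne.symm hD)
  have hden : 1 + (2 * d - 1) * (1 / (2 * d - 1)) ^ 2 - 2 * d * (1 / (2 * d - 1)) * D =
      2 * d * (1 - D) / (2 * d - 1) := by
    field_simp
    ring
  have hden_ne : 1 + (2 * d - 1) * (1 / (2 * d - 1)) ^ 2 - 2 * d * (1 / (2 * d - 1)) * D ≠ 0 := by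
    rw [hden]
    exact div_ne_zero (mul_ne_zero (mul_ne_zero two_ne_zero hd0) h2) h1
  rw [div_eq_iff hden_ne, hden]
  field_simp
  ring

end Literature.Barriers.CriticalPhenomena

end
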